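import Literature.Analysis.FluidPDE.PeriodicLerayGalerkinSystem
import Literature.Analysis.FluidPDE.EnergyToolkit
import Literature.Analysis.FluidPDE.LeraySeparationOfEnergyTools
import Mathlib.MeasureTheory.Integral.MeanInequalities
import HarnessLib

/-!
# The energy inequality of the Galerkin system ([BT1] Lemma 2.6, proof)

Analysis/FluidPDE proof file (theorems only) over `PeriodicLerayGalerkinSystem`, second layer under
the named fact `Literature.Analysis.FluidPDE.bradshawTsai2017_thm_2_4_mollified`
(Bradshaw–Tsai, Ann. Henri Poincaré 18 (2017) = arXiv:1510.07504 [BT1], Lemma 2.6). The printed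
proof of Lemma 2.6: "By multiplying the `j`-th equation of (eq:ODE) by `b_{kj}` and summing, since
certain cubic terms vanish, we obtain
`½ d/ds ‖U_k‖² + ½‖U_k‖² + ‖∇U_k‖² ≤ −(U_k·∇W, U_k) − ⟨ℛ(W), U_k⟩`. Note that (ineq:Wsmall) and
the fact that `U_k` is divergence free guarantee that `|(U_k·∇W, U_k)| ≤ ⅛‖U_k‖²_{H¹}`. By
`ℛ(W) = LW + div(W ⊗ W)`, and (ineq:Wsmall), `|(ℛ(W),U_k)| ≤ (‖LW‖_{H⁻¹} + ‖W‖²_{L⁴})‖U_k‖_{H¹}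
≤ C₂ + ⅛‖U_k‖²_{H¹}` … `d/ds ‖U_k‖² + ½‖U_k‖² + ½‖∇U_k‖² ≤ C₂`."

Here, with `U` a divergence-free test field (the ansatz `U_k(s)`), `W` satisfying the conclusions
of Lemma 2.5 with `q = 10/3` and smallness `α` (`IsRevisedProfile T (10/3) α W`), and any smooth
compactly supported kernel `ρ` (`= η_ε`):

* `galerkinForm_self_eq` — **the cubic terms vanish**: `galerkinForm W ρ s U U =
  −‖∇U‖² − ½‖U‖² + (W, (U·∇)U) + (W, (W·∇)U) − ⟨LW, U⟩` (`(y·∇U, U) = −3/2 ‖U‖²`,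
  `((W + ρ⋆U)·∇U, U) = 0`, `(U·∇W, U) = −(W, U·∇U)`, `(W·∇W, U) = −(W, W·∇U)`, by the whole-space
  integration by parts of `WholeSpaceIBP` and `div (ρ ⋆ U) = 0` of `MollifiedField`);
* `integral_norm_mul_norm_mul_sqrt_le` — **the smallness estimate**
  `∫ |W||U||∇U| ≤ ‖W‖_{L^{10/3}} K^{9/10} (‖U‖² + ‖∇U‖²)` (Hölder with exponents
  `3/10 + 1/20 + 3/20 + 1/2 = 1` on `|W|^{10/3}, |U|², |U|⁶, |∇U|²`, and the Gagliardo–Nirenberg–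
  Sobolev inequality `‖U‖₆ ≤ K‖∇U‖₂` of Mathlib, `K = eLpNormLESNormFDerivOfEqInnerConst volume 2`)
  — the tree's rendering of "`|(U_k·∇W, U_k)| ≤ ⅛‖U_k‖²_{H¹}`" once `αK^{9/10} ≤ ⅛`;
* `exists_galerkin_energy_bound` — **the energy inequality**: for an absolute `α₀ ∈ (0,1)` and
  `α ≤ α₀` there is `C₂ = 2(‖W‖²_{L^∞L⁴} + ‖LW‖_{L^∞H⁻¹})²` with
  `galerkinForm W ρ s U U ≤ C₂ − ¼‖U‖² − ¾‖∇U‖²` for all `s`, `ρ`, and divergence-free test `U`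
  — i.e. `½ d/ds‖U_k‖² ≤ C₂ − ¼‖U_k‖² − ¾‖∇U_k‖²` along the Galerkin system
  (`inner_galerkinRHS_eq_galerkinForm`), the dissipativity consumed by
  `ODE.exists_periodic_solution_of_dissipative`.

## References

* Z. Bradshaw, T.-P. Tsai, Ann. Henri Poincaré 18 (2017) = arXiv:1510.07504, proof of Lemma 2.6
  ((ineq:kenergyevolution), (ineq:1), (ineq:2), (ineq:energyevolution)) [BradshawTsai2017AHP].
-/

noncomputable section

open MeasureTheory Set Function Filter Topology TopologicalSpace Metric Module
open scoped NNReal ENNReal InnerProductSpace RealInnerProductSpace Convolution ContDiff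

namespace Literature.Analysis.FluidPDE

/-- Local notation for physical space `ℝ³ = EuclideanSpace ℝ (Fin 3)`. -/
local notation "ℝ³" => EuclideanSpace ℝ (Fin 3)

namespace BradshawTsai2017

variable {W : ℝ → ℝ³ → ℝ³} {s : ℝ} {U : ℝ³ → ℝ³}

/-! ## Integrability helpers -/

/-- A continuous function vanishing off the support of a compactly supported field is
integrable. [folklore] -/
theorem integrable_of_vanish {f : ℝ³ → ℝ} (hf : Continuous f) (hUc : HasCompactSupport U)
    (h : ∀ y, y ∉ tsupport U → f y = 0) : Integrable f (volume : Measure ℝ³) :=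
  hf.integrable_of_hasCompactSupport (hUc.mono' fun y hy => by
    by_contra h'
    exact hy (h y h'))

/-- `fderiv U` vanishes off `tsupport U`. [folklore] -/
theorem fderiv_eq_zero_of_notMem {y : ℝ³} (hy : y ∉ tsupport U) : fderiv ℝ U y = 0 :=
  fderiv_of_notMem_tsupport ℝ hy

/-! ## The cubic terms vanish: the energy identity for `galerkinForm W ρ s U U` -/

/-- `(y·∇U, U) = −(3/2)‖U‖²` for a test field `U` (`div y = 3`). [cite: BradshawTsai2017AHP, proof of Lemma 2.6 ("certain cubic terms vanish")] -/
theorem integral_inner_fderiv_apply_self_id (hU : FunctionSpaces.IsTestFunctionOn (⊤ : Opens ℝ³) U) :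
    ∫ y, ⟪fderiv ℝ U y y, U y⟫ = -(3 / 2) * ∫ y, ‖U y‖ ^ 2 := by
  have hU1 : ContDiff ℝ 1 U := hU.contDiff.of_le (by exact_mod_cast le_top)
  have h := integral_inner_convect_add_eq_zero (u := fun y : ℝ³ => y) (v := U) (w := U)
    contDiff_id hU1 hU1 hU.hasCompactSupport
  have hdiv : ∀ y : ℝ³, VectorCalculus.divergence (fun y : ℝ³ => y) y = 3 := fun y => by
    rw [VectorCalculus.divergence, fderiv_fun_id, ContinuousLinearMap.coe_id, LinearMap.trace_id,
      finrank_euclideanSpace_fin]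
    norm_num
  simp only [convect_apply, hdiv, real_inner_self_eq_norm_sq] at h
  have hsymm : ∫ y, ⟪U y, fderiv ℝ U y y⟫ = ∫ y, ⟪fderiv ℝ U y y, U y⟫ :=
    integral_congr_ae (Eventually.of_forall fun y => real_inner_comm _ _)
  rw [hsymm, integral_const_mul] at h
  linarith

/-- `((β·∇)U, U) = 0` for a test field `U` and a `C¹` divergence-free `β`. [cite: BradshawTsai2017AHP, proof of Lemma 2.6 ("certain cubic terms vanish")] -/
theorem integral_inner_fderiv_apply_divFree (hU : FunctionSpaces.IsTestFunctionOn (⊤ : Opens ℝ³) U)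
    {β : ℝ³ → ℝ³} (hβ : ContDiff ℝ 1 β) (hdiv : VectorCalculus.IsDivFree β) :
    ∫ y, ⟪fderiv ℝ U y (β y), U y⟫ = 0 := by
  have hU1 : ContDiff ℝ 1 U := hU.contDiff.of_le (by exact_mod_cast le_top)
  have h := integral_inner_convect_add_eq_zero (u := β) (v := U) (w := U) hβ hU1 hU1
    hU.hasCompactSupport
  simp only [convect_apply, hdiv _, zero_mul, integral_zero, add_zero] at h
  have hsymm : ∫ y, ⟪U y, fderiv ℝ U y (β y)⟫ = ∫ y, ⟪fderiv ℝ U y (β y), U y⟫ :=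
    integral_congr_ae (Eventually.of_forall fun y => real_inner_comm _ _)
  rw [hsymm] at h
  linarith

/-- `((U·∇)β, U) = −(β, (U·∇)U)` for a divergence-free test field `U` and a `C¹` `β`. [cite: BradshawTsai2017AHP, proof of Lemma 2.6 (the term (U_k·∇W, U_k))] -/
theorem integral_inner_fderiv_apply_eq_neg (hU : FunctionSpaces.IsTestFunctionOn (⊤ : Opens ℝ³) U)
    (hdivU : VectorCalculus.IsDivFree U) {β : ℝ³ → ℝ³} (hβ : ContDiff ℝ 1 β) :
    ∫ y, ⟪fderiv ℝ β y (U y), U y⟫ = -∫ y, ⟪β y, fderiv ℝ U y (U y)⟫ := by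
  have hU1 : ContDiff ℝ 1 U := hU.contDiff.of_le (by exact_mod_cast le_top)
  have h := integral_inner_convect_add_eq_zero (u := U) (v := β) (w := U) hU1 hβ hU1
    hU.hasCompactSupport
  simp only [convect_apply, hdivU _, zero_mul, integral_zero, add_zero] at h
  linarith

/-- `((β·∇)β, U) = −(β, (β·∇)U)` for a test field `U` and a `C¹` divergence-free `β`
("`ℛ(W) = LW + div(W ⊗ W)`"). [cite: BradshawTsai2017AHP, proof of Lemma 2.6 (the term (ℛ(W), U_k))] -/
theorem integral_inner_fderiv_self_apply_eq_neg (hU : FunctionSpaces.IsTestFunctionOn (⊤ : Opens ℝ³) U)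
    {β : ℝ³ → ℝ³} (hβ : ContDiff ℝ 1 β) (hdiv : VectorCalculus.IsDivFree β) :
    ∫ y, ⟪fderiv ℝ β y (β y), U y⟫ = -∫ y, ⟪β y, fderiv ℝ U y (β y)⟫ := by
  have hU1 : ContDiff ℝ 1 U := hU.contDiff.of_le (by exact_mod_cast le_top)
  have h := integral_inner_convect_add_eq_zero (u := β) (v := β) (w := U) hβ hβ hU1
    hU.hasCompactSupport
  simp only [convect_apply, hdiv _, zero_mul, integral_zero, add_zero] at h
  linarith

/-- **Splitting `galerkinLinear W s U U`** into its five integrals. [folklore] -/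
theorem galerkinLinear_self_eq (hU : FunctionSpaces.IsTestFunctionOn (⊤ : Opens ℝ³) U)
    (hW : SliceRegular W s) :
    galerkinLinear W s U U = -(∫ y, frobeniusNormSq (fderiv ℝ U y)) + (∫ y, ‖U y‖ ^ 2) +
      (∫ y, ⟪fderiv ℝ U y y, U y⟫) - (∫ y, ⟪fderiv ℝ U y (W s y), U y⟫) -
      ∫ y, ⟪fderiv ℝ (W s) y (U y), U y⟫ := by
  have hU1 : ContDiff ℝ 1 U := hU.contDiff.of_le (by exact_mod_cast le_top)
  have hUc := hU.contDiff.continuous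
  have hDU := hU1.continuous_fderiv one_ne_zero
  have hc := hU.hasCompactSupport
  -- the five integrands are continuous and vanish off `tsupport U`
  have i1 : Integrable (fun y => frobeniusNormSq (fderiv ℝ U y)) (volume : Measure ℝ³) :=
    integrable_of_vanish (continuous_frobeniusNormSq_comp hDU) hc fun y hy => by
      simp [fderiv_eq_zero_of_notMem hy]
  have i2 : Integrable (fun y => ‖U y‖ ^ 2) (volume : Measure ℝ³) :=
    integrable_of_vanish (hUc.norm.pow 2) hc fun y hy => by
      simp [image_eq_zero_of_notMem_tsupport hy]
  have i3 : Integrable (fun y => ⟪fderiv ℝ U y y, U y⟫) (volume : Measure ℝ³) :=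
    integrable_of_vanish ((hDU.clm_apply continuous_id).inner hUc) hc fun y hy => by
      simp [image_eq_zero_of_notMem_tsupport hy]
  have i4 : Integrable (fun y => ⟪fderiv ℝ U y (W s y), U y⟫) (volume : Measure ℝ³) :=
    integrable_of_vanish ((hDU.clm_apply hW.continuous).inner hUc) hc fun y hy => by
      simp [image_eq_zero_of_notMem_tsupport hy]
  have i5 : Integrable (fun y => ⟪fderiv ℝ (W s) y (U y), U y⟫) (volume : Measure ℝ³) :=
    integrable_of_vanish ((hW.continuous_fderiv.clm_apply hUc).inner hUc) hc fun y hy => by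
      simp [image_eq_zero_of_notMem_tsupport hy]
  have hpt : ∀ y, linearIntegrand W s U U y = -frobeniusNormSq (fderiv ℝ U y) + ‖U y‖ ^ 2 +
      ⟪fderiv ℝ U y y, U y⟫ - ⟪fderiv ℝ U y (W s y), U y⟫ - ⟪fderiv ℝ (W s) y (U y), U y⟫ := by
    intro y
    simp only [linearIntegrand, frobeniusInner_self, inner_add_left, inner_sub_left,
      real_inner_self_eq_norm_sq]
    ring
  have i1n : Integrable (fun y => -frobeniusNormSq (fderiv ℝ U y)) (volume : Measure ℝ³) := i1.neg
  have i12 : Integrable (fun y => -frobeniusNormSq (fderiv ℝ U y) + ‖U y‖ ^ 2)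
      (volume : Measure ℝ³) := i1n.add i2
  have i123 : Integrable (fun y => -frobeniusNormSq (fderiv ℝ U y) + ‖U y‖ ^ 2 +
      ⟪fderiv ℝ U y y, U y⟫) (volume : Measure ℝ³) := i12.add i3
  have i1234 : Integrable (fun y => -frobeniusNormSq (fderiv ℝ U y) + ‖U y‖ ^ 2 +
      ⟪fderiv ℝ U y y, U y⟫ - ⟪fderiv ℝ U y (W s y), U y⟫) (volume : Measure ℝ³) := i123.sub i4
  unfold galerkinLinear
  simp_rw [hpt]
  rw [integral_sub i1234 i5, integral_sub i123 i4, integral_add i12 i3, integral_add i1n i2,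
    integral_neg]

/-- **The energy identity: the cubic terms vanish.** For a divergence-free test field `U`, a
profile `W` with a `C¹` divergence-free slice at `s`, and a smooth compactly supported kernel `ρ`:
`galerkinForm W ρ s U U = −‖∇U‖² − ½‖U‖² + (W, (U·∇)U) + (W, (W·∇)U) − ⟨LW(s), U⟩`
("multiplying the `j`-th equation by `b_{kj}` and summing, since certain cubic terms vanish, we
obtain `½ d/ds‖U_k‖² + ½‖U_k‖² + ‖∇U_k‖² ≤ −(U_k·∇W, U_k) − ⟨ℛ(W), U_k⟩`", with
`(U_k·∇W,U_k) = −(W, U_k·∇U_k)` and `⟨ℛ(W),U_k⟩ = ⟨LW,U_k⟩ − (W, W·∇U_k)`). [cite: BradshawTsai2017AHP, proof of Lemma 2.6 ((ineq:kenergyevolution))] -/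
theorem galerkinForm_self_eq (hU : FunctionSpaces.IsTestFunctionOn (⊤ : Opens ℝ³) U)
    (hdivU : VectorCalculus.IsDivFree U) (hW : SliceRegular W s)
    (hdivW : VectorCalculus.IsDivFree (W s)) {ρ : ℝ³ → ℝ} (hρ : ContDiff ℝ (⊤ : ℕ∞) ρ)
    (hρc : HasCompactSupport ρ) :
    galerkinForm W ρ s U U = -(∫ y, frobeniusNormSq (fderiv ℝ U y)) - (1 / 2) * (∫ y, ‖U y‖ ^ 2) +
      (∫ y, ⟪W s y, fderiv ℝ U y (U y)⟫) + (∫ y, ⟪W s y, fderiv ℝ U y (W s y)⟫) -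
      lerayPairing W s U := by
  have hU1 : ContDiff ℝ 1 U := hU.contDiff.of_le (by exact_mod_cast le_top)
  -- the mollified drift `ρ ⋆ U` is `C¹` and divergence free
  have hm1 : ContDiff ℝ 1 (ρ ⋆[ContinuousLinearMap.lsmul ℝ ℝ, volume] U) :=
    hρc.contDiff_convolution_left _ (hρ.of_le (by exact_mod_cast le_top))
      hU.contDiff.continuous.locallyIntegrable
  have hmdiv : VectorCalculus.IsDivFree (ρ ⋆[ContinuousLinearMap.lsmul ℝ ℝ, volume] U) := fun y =>
    divergence_convolution_eq_zero hρ hρc hU.contDiff.continuous.locallyIntegrable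
      (VectorCalculus.IsDivFree.isWeaklyDivFree_holds hdivU hU1) y
  rw [galerkinForm_apply, galerkinLinear_self_eq hU hW, integral_inner_fderiv_apply_self_id hU,
    integral_inner_fderiv_apply_divFree hU hW.contDiff hdivW,
    integral_inner_fderiv_apply_eq_neg hU hdivU hW.contDiff]
  unfold galerkinTrilinear galerkinSource
  rw [integral_inner_fderiv_apply_divFree hU hm1 hmdiv,
    integral_inner_fderiv_self_apply_eq_neg hU hW.contDiff hdivW]
  ring

/-! ## The smallness estimate `∫ |W||U||∇U| ≤ ‖W‖_{10/3} K^{9/10} (‖U‖² + ‖∇U‖²)` -/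

/-- The Sobolev constant `K` of `‖u‖₆ ≤ K ‖∇u‖₂` on `ℝ³` (Mathlib's
`eLpNormLESNormFDerivOfEqInnerConst volume 2`). [folklore] -/
theorem sobolevK_nonneg : 0 ≤ (eLpNormLESNormFDerivOfEqInnerConst (volume : Measure ℝ³) 2 : ℝ) :=
  NNReal.coe_nonneg _

/-- **Four-factor Hölder inequality in `ℝ≥0∞`** with exponents `3/10 + 1/20 + 3/20 + 1/2 = 1`
(Mathlib's `ENNReal.lintegral_prod_norm_pow_le` over `Fin 4`). [folklore] -/
theorem lintegral_holder_four {f₀ f₁ f₂ f₃ : ℝ³ → ℝ≥0∞} (h₀ : AEMeasurable f₀ volume)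
    (h₁ : AEMeasurable f₁ volume) (h₂ : AEMeasurable f₂ volume) (h₃ : AEMeasurable f₃ volume) :
    ∫⁻ y, f₀ y ^ (3 / 10 : ℝ) * f₁ y ^ (1 / 20 : ℝ) * f₂ y ^ (3 / 20 : ℝ) * f₃ y ^ (1 / 2 : ℝ) ≤
      (∫⁻ y, f₀ y) ^ (3 / 10 : ℝ) * (∫⁻ y, f₁ y) ^ (1 / 20 : ℝ) * (∫⁻ y, f₂ y) ^ (3 / 20 : ℝ) *
        (∫⁻ y, f₃ y) ^ (1 / 2 : ℝ) := by
  have h := ENNReal.lintegral_prod_norm_pow_le (μ := (volume : Measure ℝ³)) Finset.univ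
    (f := ![f₀, f₁, f₂, f₃]) (p := ![3 / 10, 1 / 20, 3 / 20, 1 / 2]) ?_ ?_ ?_
  · simpa [Fin.prod_univ_four, mul_assoc] using h
  · intro i _
    fin_cases i <;> simpa
  · simp [Fin.sum_univ_four]
    norm_num
  · intro i _
    fin_cases i <;> norm_num

/-- Real exponent bookkeeping: `S^{1/20} (K⁶S³)^{3/20} S^{1/2} = K^{9/10} S`. [folklore] -/
theorem rpow_bookkeeping {K S : ℝ} (hK : 0 ≤ K) (hS : 0 ≤ S) :
    S ^ (1 / 20 : ℝ) * (K ^ 6 * S ^ 3) ^ (3 / 20 : ℝ) * S ^ (1 / 2 : ℝ) = K ^ (9 / 10 : ℝ) * S := by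
  have hK6 : 0 ≤ K ^ 6 := by positivity
  have hS3 : 0 ≤ S ^ 3 := by positivity
  rw [Real.mul_rpow hK6 hS3]
  have e1 : (K ^ 6 : ℝ) ^ (3 / 20 : ℝ) = K ^ (9 / 10 : ℝ) := by
    rw [show (K ^ 6 : ℝ) = K ^ (6 : ℝ) by norm_cast, ← Real.rpow_mul hK]
    rw [show (6 : ℝ) * (3 / 20) = 9 / 10 by norm_num]
  have e2 : (S ^ 3 : ℝ) ^ (3 / 20 : ℝ) = S ^ (9 / 20 : ℝ) := by
    rw [show (S ^ 3 : ℝ) = S ^ (3 : ℝ) by norm_cast, ← Real.rpow_mul hS]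
    rw [show (3 : ℝ) * (3 / 20) = 9 / 20 by norm_num]
  rw [e1, e2]
  have e3 : S ^ (1 / 20 : ℝ) * S ^ (9 / 20 : ℝ) * S ^ (1 / 2 : ℝ) = S := by
    have hexp : (1 / 20 : ℝ) + 9 / 20 + 1 / 2 = 1 := by norm_num
    rw [← Real.rpow_add' hS (by norm_num), ← Real.rpow_add' hS (by norm_num), hexp, Real.rpow_one]
  calc S ^ (1 / 20 : ℝ) * (K ^ (9 / 10 : ℝ) * S ^ (9 / 20 : ℝ)) * S ^ (1 / 2 : ℝ)
      = K ^ (9 / 10 : ℝ) * (S ^ (1 / 20 : ℝ) * S ^ (9 / 20 : ℝ) * S ^ (1 / 2 : ℝ)) := by ring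
    _ = K ^ (9 / 10 : ℝ) * S := by rw [e3]

/-- Pointwise splitting of `w u √F` into the four Hölder factors in `ℝ≥0∞`. [folklore] -/
theorem enorm_holder_split (w u : ℝ≥0∞) {F : ℝ} (hF : 0 ≤ F) :
    (w ^ (10 / 3 : ℝ)) ^ (3 / 10 : ℝ) * (u ^ (2 : ℝ)) ^ (1 / 20 : ℝ) * (u ^ (6 : ℝ)) ^ (3 / 20 : ℝ) *
        ENNReal.ofReal F ^ (1 / 2 : ℝ) = w * (u * ENNReal.ofReal (Real.sqrt F)) := by
  rw [← ENNReal.rpow_mul, ← ENNReal.rpow_mul, ← ENNReal.rpow_mul,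
    show (10 / 3 : ℝ) * (3 / 10) = 1 by norm_num, show (2 : ℝ) * (1 / 20) = 1 / 10 by norm_num,
    show (6 : ℝ) * (3 / 20) = 9 / 10 by norm_num, ENNReal.rpow_one,
    ENNReal.ofReal_rpow_of_nonneg hF (by norm_num : (0 : ℝ) ≤ 1 / 2), ← Real.sqrt_eq_rpow]
  have e4 : u ^ (1 / 10 : ℝ) * u ^ (9 / 10 : ℝ) = u := by
    rw [← ENNReal.rpow_add_of_nonneg (1 / 10 : ℝ) (9 / 10 : ℝ) (by norm_num) (by norm_num),
      show (1 / 10 : ℝ) + 9 / 10 = 1 by norm_num, ENNReal.rpow_one]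
  calc w * u ^ (1 / 10 : ℝ) * u ^ (9 / 10 : ℝ) * ENNReal.ofReal (Real.sqrt F)
      = w * (u ^ (1 / 10 : ℝ) * u ^ (9 / 10 : ℝ)) * ENNReal.ofReal (Real.sqrt F) := by ring
    _ = w * (u * ENNReal.ofReal (Real.sqrt F)) := by rw [e4]; ring

/-- `‖W₀‖_{L^{10/3}} = (∫⁻ ‖W₀‖ₑ^{10/3})^{3/10}`. [folklore] -/
theorem eLpNorm_ten_thirds_eq (W₀ : ℝ³ → ℝ³) :
    eLpNorm W₀ (10 / 3) volume = (∫⁻ y, ‖W₀ y‖ₑ ^ (10 / 3 : ℝ)) ^ (3 / 10 : ℝ) := by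
  have hne0 : (10 / 3 : ℝ≥0∞) ≠ 0 := by norm_num
  have hnetop : (10 / 3 : ℝ≥0∞) ≠ ⊤ := by
    rw [Ne, ENNReal.div_eq_top]; norm_num
  rw [eLpNorm_eq_lintegral_rpow_enorm_toReal hne0 hnetop]
  have ht : ((10 : ℝ≥0∞) / 3).toReal = 10 / 3 := by
    rw [ENNReal.toReal_div]; norm_num
  rw [ht, show (1 : ℝ) / (10 / 3) = 3 / 10 by norm_num]

/-- `∫⁻ ‖U‖ₑ^n = ofReal (∫ ‖U‖ⁿ)` for a continuous compactly supported `U` (`n` a natural number,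
as a real exponent). [folklore] -/
theorem lintegral_enorm_rpow_natCast_eq (hUc : Continuous U) (hc : HasCompactSupport U) (n : ℕ) (hn : n ≠ 0) :
    ∫⁻ y, ‖U y‖ₑ ^ (n : ℝ) = ENNReal.ofReal (∫ y, ‖U y‖ ^ n) := by
  have i : Integrable (fun y => ‖U y‖ ^ n) (volume : Measure ℝ³) :=
    (hUc.norm.pow n).integrable_of_hasCompactSupport
      (hc.norm.comp_left (g := fun r : ℝ => r ^ n) (by simp [hn]))
  rw [ofReal_integral_eq_lintegral_ofReal i (Eventually.of_forall fun y => by positivity)]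
  refine lintegral_congr fun y => ?_
  rw [ENNReal.rpow_natCast, ← ofReal_norm, ENNReal.ofReal_pow (norm_nonneg _)]

/-- **The smallness estimate in `ℝ≥0∞`**: `∫⁻ ‖W₀‖ₑ ‖U‖ₑ |∇U| ≤ ofReal (α K^{9/10} (E + D))`. [cite: BradshawTsai2017AHP, proof of Lemma 2.6 ((ineq:1))] -/
theorem lintegral_smallness {W₀ : ℝ³ → ℝ³} (hW₀ : Continuous W₀) {α : ℝ} (hα : 0 ≤ α)
    (hWq : eLpNorm W₀ (10 / 3) volume ≤ ENNReal.ofReal α) (hU : ContDiff ℝ 1 U)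
    (hUc : HasCompactSupport U) :
    ∫⁻ y, ‖W₀ y‖ₑ * (‖U y‖ₑ * ENNReal.ofReal (Real.sqrt (frobeniusNormSq (fderiv ℝ U y)))) ≤
      ENNReal.ofReal (α * (eLpNormLESNormFDerivOfEqInnerConst (volume : Measure ℝ³) 2 : ℝ) ^ (9 / 10 : ℝ) *
        ((∫ y, ‖U y‖ ^ 2) + ∫ y, frobeniusNormSq (fderiv ℝ U y))) := by
  have hK : 0 ≤ (eLpNormLESNormFDerivOfEqInnerConst (volume : Measure ℝ³) 2 : ℝ) := sobolevK_nonneg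
  have hUcont := hU.continuous
  have hDU := hU.continuous_fderiv one_ne_zero
  have hE0 : 0 ≤ ∫ y, ‖U y‖ ^ 2 := integral_nonneg fun y => sq_nonneg _
  have hD0 : 0 ≤ ∫ y, frobeniusNormSq (fderiv ℝ U y) :=
    integral_nonneg fun y => frobeniusNormSq_nonneg _
  have hS0 : 0 ≤ (∫ y, ‖U y‖ ^ 2) + ∫ y, frobeniusNormSq (fderiv ℝ U y) := add_nonneg hE0 hD0
  have hDc : HasCompactSupport fun y => frobeniusNormSq (fderiv ℝ U y) :=
    (hUc.fderiv ℝ).comp_left (g := frobeniusNormSq) frobeniusNormSq_zero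
  have iD : Integrable (fun y => frobeniusNormSq (fderiv ℝ U y)) (volume : Measure ℝ³) :=
    (continuous_frobeniusNormSq_comp hDU).integrable_of_hasCompactSupport hDc
  -- measurability of the four factors
  have m₀ : AEMeasurable (fun y => ‖W₀ y‖ₑ ^ (10 / 3 : ℝ)) volume :=
    hW₀.enorm.aemeasurable.pow_const _
  have m₁ : AEMeasurable (fun y => ‖U y‖ₑ ^ (2 : ℝ)) volume := hUcont.enorm.aemeasurable.pow_const _
  have m₂ : AEMeasurable (fun y => ‖U y‖ₑ ^ (6 : ℝ)) volume := hUcont.enorm.aemeasurable.pow_const _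
  have m₃ : AEMeasurable (fun y => ENNReal.ofReal (frobeniusNormSq (fderiv ℝ U y))) volume :=
    (continuous_frobeniusNormSq_comp hDU).measurable.ennreal_ofReal.aemeasurable
  -- Hölder
  have hH := lintegral_holder_four m₀ m₁ m₂ m₃
  simp only [enorm_holder_split _ _ (frobeniusNormSq_nonneg _)] at hH
  refine hH.trans ?_
  -- the four integrals
  have I₀ : (∫⁻ y, ‖W₀ y‖ₑ ^ (10 / 3 : ℝ)) ^ (3 / 10 : ℝ) ≤ ENNReal.ofReal α := by
    rw [← eLpNorm_ten_thirds_eq]; exact hWq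
  have I₁ : ∫⁻ y, ‖U y‖ₑ ^ (2 : ℝ) = ENNReal.ofReal (∫ y, ‖U y‖ ^ 2) := by
    exact_mod_cast lintegral_enorm_rpow_natCast_eq hUcont hUc 2 two_ne_zero
  have I₂ : ∫⁻ y, ‖U y‖ₑ ^ (6 : ℝ) ≤ ENNReal.ofReal
      ((eLpNormLESNormFDerivOfEqInnerConst (volume : Measure ℝ³) 2 : ℝ) ^ 6 *
        ((∫ y, ‖U y‖ ^ 2) + ∫ y, frobeniusNormSq (fderiv ℝ U y)) ^ 3) := by
    have h6 : ∫⁻ y, ‖U y‖ₑ ^ (6 : ℝ) = ENNReal.ofReal (∫ y, ‖U y‖ ^ 6) := by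
      exact_mod_cast lintegral_enorm_rpow_natCast_eq hUcont hUc 6 (by norm_num)
    rw [h6]
    refine ENNReal.ofReal_le_ofReal ?_
    have hsob := integral_norm_pow_six_le (volume : Measure ℝ³) finrank_euclideanSpace_fin hU hUc
    have hop : ∫ y, ‖fderiv ℝ U y‖ ^ 2 ≤ ∫ y, frobeniusNormSq (fderiv ℝ U y) :=
      integral_mono_of_nonneg (Eventually.of_forall fun y => sq_nonneg _) iD
        (Eventually.of_forall fun y => norm_sq_le_frobeniusNormSq _)
    have hop0 : 0 ≤ ∫ y, ‖fderiv ℝ U y‖ ^ 2 := integral_nonneg fun y => sq_nonneg _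
    have hDS : ∫ y, frobeniusNormSq (fderiv ℝ U y) ≤
        (∫ y, ‖U y‖ ^ 2) + ∫ y, frobeniusNormSq (fderiv ℝ U y) := le_add_of_nonneg_left hE0
    calc ∫ y, ‖U y‖ ^ 6
        ≤ (eLpNormLESNormFDerivOfEqInnerConst (volume : Measure ℝ³) 2 : ℝ) ^ 6 *
            (∫ y, ‖fderiv ℝ U y‖ ^ 2) ^ 3 := hsob
      _ ≤ (eLpNormLESNormFDerivOfEqInnerConst (volume : Measure ℝ³) 2 : ℝ) ^ 6 *
            (∫ y, frobeniusNormSq (fderiv ℝ U y)) ^ 3 := by gcongr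
      _ ≤ _ := by gcongr
  have I₃ : ∫⁻ y, ENNReal.ofReal (frobeniusNormSq (fderiv ℝ U y)) =
      ENNReal.ofReal (∫ y, frobeniusNormSq (fderiv ℝ U y)) :=
    (ofReal_integral_eq_lintegral_ofReal iD
      (Eventually.of_forall fun y => frobeniusNormSq_nonneg _)).symm
  rw [I₁, I₃]
  -- monotonicity and bookkeeping
  set K : ℝ := (eLpNormLESNormFDerivOfEqInnerConst (volume : Measure ℝ³) 2 : ℝ) with hKdef
  set E : ℝ := ∫ y, ‖U y‖ ^ 2 with hE
  set D : ℝ := ∫ y, frobeniusNormSq (fderiv ℝ U y) with hD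
  have hES : E ≤ E + D := le_add_of_nonneg_right hD0
  have hDS : D ≤ E + D := le_add_of_nonneg_left hE0
  have hKS : 0 ≤ K ^ 6 * (E + D) ^ 3 := by positivity
  calc (∫⁻ y, ‖W₀ y‖ₑ ^ (10 / 3 : ℝ)) ^ (3 / 10 : ℝ) * ENNReal.ofReal E ^ (1 / 20 : ℝ) *
        (∫⁻ y, ‖U y‖ₑ ^ (6 : ℝ)) ^ (3 / 20 : ℝ) * ENNReal.ofReal D ^ (1 / 2 : ℝ)
      ≤ ENNReal.ofReal α * ENNReal.ofReal (E + D) ^ (1 / 20 : ℝ) *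
        ENNReal.ofReal (K ^ 6 * (E + D) ^ 3) ^ (3 / 20 : ℝ) * ENNReal.ofReal (E + D) ^ (1 / 2 : ℝ) := by
        gcongr
    _ = ENNReal.ofReal (α * K ^ (9 / 10 : ℝ) * (E + D)) := by
        rw [ENNReal.ofReal_rpow_of_nonneg hS0 (by norm_num), ENNReal.ofReal_rpow_of_nonneg hKS (by norm_num),
          ENNReal.ofReal_rpow_of_nonneg hS0 (by norm_num), ← ENNReal.ofReal_mul hα,
          ← ENNReal.ofReal_mul (by positivity), ← ENNReal.ofReal_mul (by positivity)]
        congr 1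
        rw [mul_assoc α, mul_assoc α, mul_assoc α, rpow_bookkeeping hK hS0]

/-- **The smallness estimate** ("`|(U_k·∇W, U_k)| ≤ ⅛‖U_k‖²_{H¹}`" before choosing `α`): for a
continuous `W₀` with `‖W₀‖_{L^{10/3}} ≤ α` and a `C¹` compactly supported `U`,
`∫ |W₀| |U| |∇U| ≤ α K^{9/10} (‖U‖²_{L²} + ‖∇U‖²_{L²})`, `|∇U|` the Frobenius norm,
`K` the Sobolev constant: Hölder with exponents `3/10, 1/20, 3/20, 1/2` on
`|W₀|^{10/3}, |U|², |U|⁶, |∇U|²`, then `∫|U|⁶ ≤ K⁶(∫|∇U|²)³` (Gagliardo–Nirenberg–Sobolev) and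
`‖U‖₂², ‖∇U‖₂² ≤ ‖U‖₂² + ‖∇U‖₂²`. [cite: BradshawTsai2017AHP, proof of Lemma 2.6 ((ineq:1))] -/
theorem integral_norm_mul_norm_mul_sqrt_le {W₀ : ℝ³ → ℝ³} (hW₀ : Continuous W₀) {α : ℝ} (hα : 0 ≤ α)
    (hWq : eLpNorm W₀ (10 / 3) volume ≤ ENNReal.ofReal α) (hU : ContDiff ℝ 1 U)
    (hUc : HasCompactSupport U) :
    ∫ y, ‖W₀ y‖ * (‖U y‖ * Real.sqrt (frobeniusNormSq (fderiv ℝ U y))) ≤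
      α * (eLpNormLESNormFDerivOfEqInnerConst (volume : Measure ℝ³) 2 : ℝ) ^ (9 / 10 : ℝ) *
        ((∫ y, ‖U y‖ ^ 2) + ∫ y, frobeniusNormSq (fderiv ℝ U y)) := by
  have hUcont := hU.continuous
  have hDU := hU.continuous_fderiv one_ne_zero
  have hE0 : 0 ≤ ∫ y, ‖U y‖ ^ 2 := integral_nonneg fun y => sq_nonneg _
  have hD0 : 0 ≤ ∫ y, frobeniusNormSq (fderiv ℝ U y) :=
    integral_nonneg fun y => frobeniusNormSq_nonneg _
  have hnn : 0 ≤ᵐ[volume] fun y => ‖W₀ y‖ * (‖U y‖ * Real.sqrt (frobeniusNormSq (fderiv ℝ U y))) :=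
    Eventually.of_forall fun y => by positivity
  have hmeas : AEStronglyMeasurable
      (fun y => ‖W₀ y‖ * (‖U y‖ * Real.sqrt (frobeniusNormSq (fderiv ℝ U y)))) volume :=
    (hW₀.norm.mul (hUcont.norm.mul
      ((continuous_frobeniusNormSq_comp hDU).sqrt))).aestronglyMeasurable
  rw [integral_eq_lintegral_of_nonneg_ae hnn hmeas]
  have hpt : ∀ y, ENNReal.ofReal (‖W₀ y‖ * (‖U y‖ * Real.sqrt (frobeniusNormSq (fderiv ℝ U y)))) =
      ‖W₀ y‖ₑ * (‖U y‖ₑ * ENNReal.ofReal (Real.sqrt (frobeniusNormSq (fderiv ℝ U y)))) := fun y => by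
    rw [ENNReal.ofReal_mul (norm_nonneg _), ENNReal.ofReal_mul (norm_nonneg _), ofReal_norm,
      ofReal_norm]
  simp_rw [hpt]
  have h := lintegral_smallness hW₀ hα hWq hU hUc
  have hfin := ENNReal.toReal_mono ENNReal.ofReal_ne_top h
  rwa [ENNReal.toReal_ofReal (by positivity)] at hfin

/-! ## The `L⁴` term and the assembly of the energy inequality -/

/-- `‖L v‖ ≤ √|L|² ‖v‖` (operator norm below the Frobenius norm). [folklore] -/
theorem norm_apply_le_sqrt_frobenius_mul (L : ℝ³ →L[ℝ] ℝ³) (v : ℝ³) :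
    ‖L v‖ ≤ Real.sqrt (frobeniusNormSq L) * ‖v‖ := by
  have h1 : ‖L‖ ≤ Real.sqrt (frobeniusNormSq L) := by
    rw [← Real.sqrt_sq (norm_nonneg L)]
    exact Real.sqrt_le_sqrt (norm_sq_le_frobeniusNormSq L)
  exact (L.le_opNorm v).trans (mul_le_mul_of_nonneg_right h1 (norm_nonneg _))

/-- **The `L⁴` term**: `|(W₀, (W₀·∇)U)| ≤ ‖W₀‖²_{L⁴} ‖∇U‖_{L²}` for `W₀ ∈ L⁴` continuous and a
`C¹` compactly supported `U` ("`|(ℛ(W), U_k)| ≤ (‖LW‖_{H⁻¹} + ‖W‖²_{L⁴})‖U_k‖_{H¹}`"). [cite: BradshawTsai2017AHP, proof of Lemma 2.6 ((ineq:2))] -/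
theorem integral_inner_fderiv_apply_le_L4 {W₀ : ℝ³ → ℝ³} (hW₀ : Continuous W₀)
    (hW4 : eLpNorm W₀ 4 volume < ⊤) (hU : ContDiff ℝ 1 U) (hUc : HasCompactSupport U) :
    ∫ y, ⟪W₀ y, fderiv ℝ U y (W₀ y)⟫ ≤
      Real.sqrt (∫ y, ‖W₀ y‖ ^ 4) * Real.sqrt (∫ y, frobeniusNormSq (fderiv ℝ U y)) := by
  have hDU := hU.continuous_fderiv one_ne_zero
  -- pointwise bound
  have hpt : ∀ y, ⟪W₀ y, fderiv ℝ U y (W₀ y)⟫ ≤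
      ‖W₀ y‖ ^ 2 * Real.sqrt (frobeniusNormSq (fderiv ℝ U y)) := fun y => by
    calc ⟪W₀ y, fderiv ℝ U y (W₀ y)⟫ ≤ ‖W₀ y‖ * ‖fderiv ℝ U y (W₀ y)‖ := real_inner_le_norm _ _
      _ ≤ ‖W₀ y‖ * (Real.sqrt (frobeniusNormSq (fderiv ℝ U y)) * ‖W₀ y‖) :=
          mul_le_mul_of_nonneg_left (norm_apply_le_sqrt_frobenius_mul _ _) (norm_nonneg _)
      _ = ‖W₀ y‖ ^ 2 * Real.sqrt (frobeniusNormSq (fderiv ℝ U y)) := by ring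
  -- `‖W₀‖² ∈ L²`, `√|∇U|² ∈ L²`
  have hf : MemLp (fun y => ‖W₀ y‖ ^ 2) 2 (volume : Measure ℝ³) := by
    refine ⟨(hW₀.norm.pow 2).aestronglyMeasurable, ?_⟩
    rw [eLpNorm_norm_sq_two]
    exact ENNReal.pow_lt_top hW4
  have hgc : HasCompactSupport fun y => Real.sqrt (frobeniusNormSq (fderiv ℝ U y)) :=
    (hUc.fderiv ℝ).comp_left (g := fun L => Real.sqrt (frobeniusNormSq L)) (by simp)
  have hg : MemLp (fun y => Real.sqrt (frobeniusNormSq (fderiv ℝ U y))) 2 (volume : Measure ℝ³) :=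
    (continuous_frobeniusNormSq_comp hDU).sqrt.memLp_of_hasCompactSupport hgc
  -- integrability of the left integrand
  have hi : Integrable (fun y => ⟪W₀ y, fderiv ℝ U y (W₀ y)⟫) (volume : Measure ℝ³) := by
    refine (hW₀.inner (hDU.clm_apply hW₀)).integrable_of_hasCompactSupport ?_
    exact (hUc.fderiv ℝ).mono' fun y hy => by
      by_contra h
      exact hy (by simp [image_eq_zero_of_notMem_tsupport h])
  have hprod : Integrable (fun y => ‖W₀ y‖ ^ 2 * Real.sqrt (frobeniusNormSq (fderiv ℝ U y)))
      (volume : Measure ℝ³) := by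
    have := hf.integrable_mul hg
    exact this
  calc ∫ y, ⟪W₀ y, fderiv ℝ U y (W₀ y)⟫
      ≤ ∫ y, ‖W₀ y‖ ^ 2 * Real.sqrt (frobeniusNormSq (fderiv ℝ U y)) :=
        integral_mono hi hprod hpt
    _ ≤ Real.sqrt (∫ y, (‖W₀ y‖ ^ 2) ^ 2) *
          Real.sqrt (∫ y, Real.sqrt (frobeniusNormSq (fderiv ℝ U y)) ^ 2) :=
        integral_mul_le_sqrt_mul_sqrt_of_memLp hf hg
    _ = Real.sqrt (∫ y, ‖W₀ y‖ ^ 4) * Real.sqrt (∫ y, frobeniusNormSq (fderiv ℝ U y)) := by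
        congr 2
        · exact integral_congr_ae (Eventually.of_forall fun y => by ring)
        · exact integral_congr_ae (Eventually.of_forall fun y =>
            Real.sq_sqrt (frobeniusNormSq_nonneg _))

/-- The pointwise `L⁴` bound of a revised profile: `∫ |W(s)|⁴ ≤ (sup_s ‖W(s)‖_{L⁴})⁴ < ∞`. [folklore] -/
theorem integral_norm_pow_four_le_of_iSup {W : ℝ → ℝ³ → ℝ³}
    (hW4 : ⨆ s, eLpNorm (W s) 4 volume < ⊤) (hWc : ∀ s, Continuous (W s)) (s : ℝ) :
    ∫ y, ‖W s y‖ ^ 4 ≤ ((⨆ s, eLpNorm (W s) 4 volume) ^ 4).toReal := by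
  set M := ⨆ s, eLpNorm (W s) 4 volume with hM
  have hs : eLpNorm (W s) 4 volume ≤ M := le_iSup (fun s => eLpNorm (W s) 4 volume) s
  have hlt : eLpNorm (W s) 4 volume < ⊤ := hs.trans_lt hW4
  have hmem : MemLp (W s) 4 (volume : Measure ℝ³) := ⟨(hWc s).aestronglyMeasurable, hlt⟩
  have hint : Integrable (fun y => ‖W s y‖ ^ 4) (volume : Measure ℝ³) := by
    have := hmem.integrable_norm_pow (by norm_num : (4 : ℕ) ≠ 0)
    simpa using this
  have e4 : ENNReal.ofReal (∫ y, ‖W s y‖ ^ 4) = eLpNorm (W s) 4 volume ^ 4 := by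
    rw [ofReal_integral_eq_lintegral_ofReal hint (Eventually.of_forall fun y => by positivity)]
    have := eLpNorm_eq_lintegral_rpow_enorm_toReal (p := 4) (by norm_num) (by norm_num)
      (f := W s) (μ := (volume : Measure ℝ³))
    rw [this]
    simp only [ENNReal.toReal_ofNat, one_div]
    rw [← ENNReal.rpow_natCast, ← ENNReal.rpow_mul]
    norm_num
  have h0 : 0 ≤ ∫ y, ‖W s y‖ ^ 4 := integral_nonneg fun y => by positivity
  have hle : ENNReal.ofReal (∫ y, ‖W s y‖ ^ 4) ≤ M ^ 4 := by
    rw [e4]; gcongr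
  have htop : M ^ 4 ≠ ⊤ := ENNReal.pow_ne_top hW4.ne
  have := ENNReal.toReal_mono htop hle
  rwa [ENNReal.toReal_ofReal h0] at this

/-- **The energy inequality of the Galerkin system ([BT1] Lemma 2.6, proof).** There is an
absolute `α₀ ∈ (0,1)` such that for every profile `W` satisfying the conclusions of Lemma 2.5 with
`q = 10/3` and smallness `α ∈ [0, α₀]` (`IsRevisedProfile T (10/3) α W`) there is
`C₂ ≥ 0` (`= 2(‖W‖²_{L^∞L⁴} + ‖LW‖_{L^∞H⁻¹})²`) with
`galerkinForm W ρ s U U ≤ C₂ − ¼ ‖U‖²_{L²} − ¾ ‖∇U‖²_{L²}`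
for all `s`, all smooth compactly supported kernels `ρ` and all divergence-free test fields `U`.
Along the Galerkin system (`⟪F(s,b),b⟫ = galerkinForm W ρ s U_k U_k`, `‖b‖ = ‖U_k‖_{L²}`) this
is the printed "`d/ds ‖U_k‖² + ½‖U_k‖² + ½‖∇U_k‖² ≤ C₂`" (indeed with `¾` in place of `½` on the
gradient). Proof: `galerkinForm_self_eq`, `|(W,(U·∇)U)| ≤ αK^{9/10}(E + D) ≤ ⅛(E + D)`
(`α₀ = 1/(8(K^{9/10}+1))`), `(W,(W·∇)U) ≤ ‖W‖₄² √D`, `|⟨LW,U⟩| ≤ c√(E + D)` (`leray_dual`), and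
`m√(E+D) ≤ ⅛(E+D) + 2m²`. [cite: BradshawTsai2017AHP, proof of Lemma 2.6 ((ineq:energyevolution))] -/
theorem exists_galerkin_energy_bound :
    ∃ α₀ : ℝ, 0 < α₀ ∧ α₀ < 1 ∧
      ∀ {T : ℝ} {α : ℝ} {W : ℝ → ℝ³ → ℝ³}, IsRevisedProfile T (10 / 3) α W → 0 ≤ α → α ≤ α₀ →
        ∃ C₂ : ℝ, 0 ≤ C₂ ∧ ∀ (s : ℝ) {ρ : ℝ³ → ℝ}, ContDiff ℝ (⊤ : ℕ∞) ρ → HasCompactSupport ρ →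
          ∀ {U : ℝ³ → ℝ³}, FunctionSpaces.IsTestFunctionOn (⊤ : Opens ℝ³) U →
            VectorCalculus.IsDivFree U →
            galerkinForm W ρ s U U ≤ C₂ - (1 / 4) * (∫ y, ‖U y‖ ^ 2) -
              (3 / 4) * ∫ y, frobeniusNormSq (fderiv ℝ U y) := by
  set K : ℝ := (eLpNormLESNormFDerivOfEqInnerConst (volume : Measure ℝ³) 2 : ℝ) with hKdef
  have hK : 0 ≤ K := sobolevK_nonneg
  have hK9 : 0 ≤ K ^ (9 / 10 : ℝ) := Real.rpow_nonneg hK _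
  refine ⟨1 / (8 * (K ^ (9 / 10 : ℝ) + 1)), by positivity, ?_, ?_⟩
  · rw [div_lt_one (by positivity)]
    nlinarith
  intro T α W hW hα hαle
  -- the smallness `α K^{9/10} ≤ 1/8`
  have hsmall : α * K ^ (9 / 10 : ℝ) ≤ 1 / 8 := by
    calc α * K ^ (9 / 10 : ℝ) ≤ 1 / (8 * (K ^ (9 / 10 : ℝ) + 1)) * K ^ (9 / 10 : ℝ) :=
          mul_le_mul_of_nonneg_right hαle hK9
      _ ≤ 1 / (8 * (K ^ (9 / 10 : ℝ) + 1)) * (K ^ (9 / 10 : ℝ) + 1) := by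
          gcongr; linarith
      _ = 1 / 8 := by field_simp
  -- the constants of `W`
  obtain ⟨c, hc⟩ := hW.leray_dual
  set L4 : ℝ := ((⨆ s, eLpNorm (W s) 4 volume) ^ 4).toReal with hL4
  have hL40 : 0 ≤ L4 := ENNReal.toReal_nonneg
  set m : ℝ := Real.sqrt L4 + c with hm
  have hm0 : 0 ≤ m := add_nonneg (Real.sqrt_nonneg _) (NNReal.coe_nonneg c)
  refine ⟨2 * m ^ 2, by positivity, ?_⟩
  intro s ρ hρ hρc U hU hdivU
  have hreg : SliceRegular W s := SliceRegular.of_contDiff hW.contDiff s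
  have hU1 : ContDiff ℝ 1 U := hU.contDiff.of_le (by exact_mod_cast le_top)
  set E : ℝ := ∫ y, ‖U y‖ ^ 2 with hE
  set D : ℝ := ∫ y, frobeniusNormSq (fderiv ℝ U y) with hD
  have hE0 : 0 ≤ E := integral_nonneg fun y => sq_nonneg _
  have hD0 : 0 ≤ D := integral_nonneg fun y => frobeniusNormSq_nonneg _
  -- the identity
  rw [galerkinForm_self_eq hU hdivU hreg (hW.divFree s) hρ hρc]
  -- the three estimates
  have hDU := hU1.continuous_fderiv one_ne_zero
  have hUcont := hU.contDiff.continuous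
  have h1 : ∫ y, ⟪W s y, fderiv ℝ U y (U y)⟫ ≤ (1 / 8) * (E + D) := by
    have hle : ∫ y, ⟪W s y, fderiv ℝ U y (U y)⟫ ≤
        ∫ y, ‖W s y‖ * (‖U y‖ * Real.sqrt (frobeniusNormSq (fderiv ℝ U y))) := by
      refine integral_mono ?_ ?_ fun y => ?_
      · exact (hreg.continuous.inner (hDU.clm_apply hUcont)).integrable_of_hasCompactSupport
          (hU.hasCompactSupport.mono' fun y hy => by
            by_contra h
            exact hy (by simp [image_eq_zero_of_notMem_tsupport h]))
      · exact (hreg.continuous.norm.mul (hUcont.norm.mul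
          (continuous_frobeniusNormSq_comp hDU).sqrt)).integrable_of_hasCompactSupport
          (hU.hasCompactSupport.mono' fun y hy => by
            by_contra h
            exact hy (by simp [image_eq_zero_of_notMem_tsupport h]))
      · calc ⟪W s y, fderiv ℝ U y (U y)⟫ ≤ ‖W s y‖ * ‖fderiv ℝ U y (U y)‖ := real_inner_le_norm _ _
          _ ≤ ‖W s y‖ * (Real.sqrt (frobeniusNormSq (fderiv ℝ U y)) * ‖U y‖) :=
              mul_le_mul_of_nonneg_left (norm_apply_le_sqrt_frobenius_mul _ _) (norm_nonneg _)
          _ = ‖W s y‖ * (‖U y‖ * Real.sqrt (frobeniusNormSq (fderiv ℝ U y))) := by ring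
    have hsm := integral_norm_mul_norm_mul_sqrt_le hreg.continuous hα (hW.small s) hU1
      hU.hasCompactSupport
    have hED : 0 ≤ E + D := add_nonneg hE0 hD0
    calc ∫ y, ⟪W s y, fderiv ℝ U y (U y)⟫
        ≤ α * K ^ (9 / 10 : ℝ) * (E + D) := hle.trans hsm
      _ ≤ (1 / 8) * (E + D) := mul_le_mul_of_nonneg_right hsmall hED
  set y₀ : ℝ := Real.sqrt (E + D) with hy₀
  have hy₀0 : 0 ≤ y₀ := Real.sqrt_nonneg _
  have hy₀sq : y₀ ^ 2 = E + D := Real.sq_sqrt (add_nonneg hE0 hD0)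
  have h2 : ∫ y, ⟪W s y, fderiv ℝ U y (W s y)⟫ ≤ Real.sqrt L4 * y₀ := by
    have hlt : eLpNorm (W s) 4 volume < ⊤ :=
      (le_iSup (fun s => eLpNorm (W s) 4 volume) s).trans_lt hW.memL4
    have h := integral_inner_fderiv_apply_le_L4 hreg.continuous hlt hU1 hU.hasCompactSupport
    refine h.trans (mul_le_mul ?_ ?_ (Real.sqrt_nonneg _) (Real.sqrt_nonneg _))
    · exact Real.sqrt_le_sqrt (integral_norm_pow_four_le_of_iSup hW.memL4
        (fun s => (SliceRegular.of_contDiff hW.contDiff s).continuous) s)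
    · exact Real.sqrt_le_sqrt (le_add_of_nonneg_left hE0)
  have h3 : -lerayPairing W s U ≤ c * y₀ := by
    have h := hc s U hU
    have e : h1Norm U = y₀ := rfl
    rw [e, abs_le] at h
    linarith [h.1]
  have hmy : m * y₀ ≤ (1 / 8) * (E + D) + 2 * m ^ 2 := by
    nlinarith [sq_nonneg (y₀ - 4 * m), hy₀sq]
  have hsum : Real.sqrt L4 * y₀ + c * y₀ = m * y₀ := by rw [hm]; ring
  nlinarith [h1, h2, h3, hmy, hsum, hE0, hD0]

end BradshawTsai2017

end Literature.Analysis.FluidPDE
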